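import Literature.MathematicalPhysics.QuantumManyBody.FubiniStudyAngle
import HarnessLib

/-!
# Rigidity of near-minimisers along the impurity coupling path: from existential to universal
Fubini–Study closeness

Topic `Literature/MathematicalPhysics/QuantumManyBody` (companion of `PeriodicBoseGasCouplingPath.lean`
and `FubiniStudyAngle.lean`; wanted by crux stmt-AtomisticToContinuum-12058, line `llp-fidelity-arc`,
whose skeleton uses these two lemmas to pass from its existential heart stub to the universal local
speed bounds consumed by `CouplingPathArcChord.lean`). Theorems only.

Along the coupling path `λ ↦ H_λ` of `coupledEnergy v λ` on tagged torus states, a "`δ`-near-minimiser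
at `λ`" is a state `Ψ` with `coupledEnergy v λ Ψ ≤ coupledGroundStateEnergy v λ N L + δ`. Two notions
of closeness of the near-minimiser clouds at two couplings `λ`, `λ'` occur:

* EXISTENTIAL: for every `δ > 0` there is a PAIR of `δ`-near-minimisers within Fubini–Study angle `B`
  (a statement about the ground RAYS when they exist: `d(g_λ, g_λ') ≤ B`);
* UNIVERSAL: for some `δ > 0` EVERY pair of `δ`-near-minimisers is within angle `B'` (the
  derivative-free "local speed bound" of the line).

`forall_fsAngle_le_of_rigidity`: if at each of the two couplings the `δ`-near-minimisers collapse to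
one ray as `δ → 0` (RIGIDITY: `∀ ε > 0 ∃ δ > 0`, any two `δ`-near-minimisers are within angle `ε` — the
fixed-volume spectral frame: gap + simple ground state), then existential closeness within `B`
upgrades to universal closeness within `B + σ` for every slack `σ > 0` (triangle inequality of the
Fubini–Study angle, `fsAngle_triangle`, twice). `localSpeedBound_of_rigidity`: on `[0,1]`, an
integrable EXISTENTIAL speed majorant `s` at a node `λ` plus rigidity at every coupling gives the
UNIVERSAL local speed bound with the floored majorant `s + c`, any `c > 0` — the slack `c·|λ' − λ| > 0`
absorbs the near-minimiser fuzz. (A universal majorant must have positive mass on every subinterval: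
`δ`-near-minimisers at one coupling never form a single ray for `δ > 0`; so the floor is not an
artefact.) [folklore; the Fubini–Study metric of Gu2010 §2]
-/

noncomputable section

open MeasureTheory
open scoped ENNReal

namespace Literature.MathematicalPhysics.QuantumManyBody.BoseGas

/-- **Rigidity upgrades existential closeness to universal closeness, at the price of any slack.**
If the `δ`-near-minimisers at `λ` and at `λ'` each collapse to one ray as `δ → 0`, and arbitrarily
accurate near-minimiser PAIRS at `(λ, λ')` exist within angle `B`, then for some `δ > 0` ALL
`δ`-near-minimiser pairs are within angle `B + σ`, for every `σ > 0` (Fubini–Study triangle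
inequality twice). [folklore] -/
theorem forall_fsAngle_le_of_rigidity {N : ℕ} {L : ℝ} {v : ℝ → ℝ≥0∞} {lam lam' B σ : ℝ}
    (hσ : 0 < σ)
    (hrig : ∀ ε : ℝ, 0 < ε → ∃ δ : ℝ≥0∞, 0 < δ ∧ ∀ Ψ Ψ' : TaggedPeriodicTrialState N L,
      coupledEnergy v lam Ψ ≤ coupledGroundStateEnergy v lam N L + δ →
      coupledEnergy v lam Ψ' ≤ coupledGroundStateEnergy v lam N L + δ → fsAngle Ψ Ψ' ≤ ε)
    (hrig' : ∀ ε : ℝ, 0 < ε → ∃ δ : ℝ≥0∞, 0 < δ ∧ ∀ Ψ Ψ' : TaggedPeriodicTrialState N L,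
      coupledEnergy v lam' Ψ ≤ coupledGroundStateEnergy v lam' N L + δ →
      coupledEnergy v lam' Ψ' ≤ coupledGroundStateEnergy v lam' N L + δ → fsAngle Ψ Ψ' ≤ ε)
    (hex : ∀ δ : ℝ≥0∞, 0 < δ → ∃ Ψ Ψ' : TaggedPeriodicTrialState N L,
      coupledEnergy v lam Ψ ≤ coupledGroundStateEnergy v lam N L + δ ∧
      coupledEnergy v lam' Ψ' ≤ coupledGroundStateEnergy v lam' N L + δ ∧ fsAngle Ψ Ψ' ≤ B) :
    ∃ δ : ℝ≥0∞, 0 < δ ∧ ∀ Ψ Ψ' : TaggedPeriodicTrialState N L,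
      coupledEnergy v lam Ψ ≤ coupledGroundStateEnergy v lam N L + δ →
      coupledEnergy v lam' Ψ' ≤ coupledGroundStateEnergy v lam' N L + δ →
        fsAngle Ψ Ψ' ≤ B + σ := by
  obtain ⟨δ₁, hδ₁, h₁⟩ := hrig (σ / 2) (by positivity)
  obtain ⟨δ₂, hδ₂, h₂⟩ := hrig' (σ / 2) (by positivity)
  obtain ⟨Φ, Φ', hΦ, hΦ', hB⟩ := hex (min δ₁ δ₂) (lt_min hδ₁ hδ₂)
  refine ⟨min δ₁ δ₂, lt_min hδ₁ hδ₂, fun Ψ Ψ' hΨ hΨ' => ?_⟩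
  have hΨ₁ : coupledEnergy v lam Ψ ≤ coupledGroundStateEnergy v lam N L + δ₁ :=
    hΨ.trans (add_le_add le_rfl (min_le_left _ _))
  have hΦ₁ : coupledEnergy v lam Φ ≤ coupledGroundStateEnergy v lam N L + δ₁ :=
    hΦ.trans (add_le_add le_rfl (min_le_left _ _))
  have hΨ₂ : coupledEnergy v lam' Ψ' ≤ coupledGroundStateEnergy v lam' N L + δ₂ :=
    hΨ'.trans (add_le_add le_rfl (min_le_right _ _))
  have hΦ₂ : coupledEnergy v lam' Φ' ≤ coupledGroundStateEnergy v lam' N L + δ₂ :=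
    hΦ'.trans (add_le_add le_rfl (min_le_right _ _))
  calc fsAngle Ψ Ψ' ≤ fsAngle Ψ Φ + fsAngle Φ Ψ' := fsAngle_triangle Ψ Φ Ψ'
    _ ≤ fsAngle Ψ Φ + (fsAngle Φ Φ' + fsAngle Φ' Ψ') :=
        add_le_add le_rfl (fsAngle_triangle Φ Φ' Ψ')
    _ ≤ σ / 2 + (B + σ / 2) :=
        add_le_add (h₁ Ψ Φ hΨ₁ hΦ₁) (add_le_add hB (h₂ Φ' Ψ' hΦ₂ hΨ₂))
    _ = B + σ := by ring

/-- **A floor converts the existential speed majorant into a universal one.** On `[0,1]`, if `s`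
is an integrable existential majorant at the node `λ` (radius `η`) and the near-minimisers are
rigid at every coupling, then `s + c` (`c > 0`) is a universal local speed majorant at `λ` with the
same radius: the slack `c·|λ' − λ| > 0` absorbs the near-minimiser fuzz (cf. the disprover's
`NegativeNote-LocalSpeedBound`: a majorant of the derivative-free bound must have positive mass on
every subinterval). [folklore] -/
theorem localSpeedBound_of_rigidity {N : ℕ} {L : ℝ} {v : ℝ → ℝ≥0∞} {s : ℝ → ℝ} {c lam η : ℝ}
    (hs : IntegrableOn s (Set.Icc (0 : ℝ) 1)) (hc : 0 < c) (hlam : lam ∈ Set.Icc (0 : ℝ) 1)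
    (hη : 0 < η)
    (hrig : ∀ μ ∈ Set.Icc (0 : ℝ) 1, ∀ ε : ℝ, 0 < ε → ∃ δ : ℝ≥0∞, 0 < δ ∧
      ∀ Ψ Ψ' : TaggedPeriodicTrialState N L,
        coupledEnergy v μ Ψ ≤ coupledGroundStateEnergy v μ N L + δ →
        coupledEnergy v μ Ψ' ≤ coupledGroundStateEnergy v μ N L + δ → fsAngle Ψ Ψ' ≤ ε)
    (hex : ∀ lam' ∈ Set.Icc (0 : ℝ) 1, lam' ≠ lam → |lam' - lam| < η →
      ∀ δ : ℝ≥0∞, 0 < δ → ∃ Ψ Ψ' : TaggedPeriodicTrialState N L,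
        coupledEnergy v lam Ψ ≤ coupledGroundStateEnergy v lam N L + δ ∧
        coupledEnergy v lam' Ψ' ≤ coupledGroundStateEnergy v lam' N L + δ ∧
          fsAngle Ψ Ψ' ≤ ∫ t in Set.uIcc lam lam', s t) :
    ∃ η' : ℝ, 0 < η' ∧ ∀ lam' ∈ Set.Icc (0 : ℝ) 1, lam' ≠ lam → |lam' - lam| < η' →
      ∃ δ : ℝ≥0∞, 0 < δ ∧ ∀ Ψ Ψ' : TaggedPeriodicTrialState N L,
        coupledEnergy v lam Ψ ≤ coupledGroundStateEnergy v lam N L + δ →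
        coupledEnergy v lam' Ψ' ≤ coupledGroundStateEnergy v lam' N L + δ →
          fsAngle Ψ Ψ' ≤ ∫ t in Set.uIcc lam lam', (s t + c) := by
  refine ⟨η, hη, fun lam' hlam' hne hlt => ?_⟩
  have hsub : Set.uIcc lam lam' ⊆ Set.Icc (0 : ℝ) 1 := Set.uIcc_subset_Icc hlam hlam'
  have hsI : IntegrableOn s (Set.uIcc lam lam') := hs.mono_set hsub
  have hvol : volume (Set.uIcc lam lam') = ENNReal.ofReal |lam' - lam| := by
    rcases le_total lam lam' with h | h
    · rw [Set.uIcc_of_le h, Real.volume_Icc, abs_of_nonneg (sub_nonneg.2 h)]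
    · rw [Set.uIcc_of_ge h, Real.volume_Icc, abs_of_nonpos (sub_nonpos.2 h), neg_sub]
  have hcI : IntegrableOn (fun _ : ℝ => c) (Set.uIcc lam lam') :=
    integrableOn_const (by rw [hvol]; exact ENNReal.ofReal_ne_top)
  have hsplit : ∫ t in Set.uIcc lam lam', (s t + c) =
      (∫ t in Set.uIcc lam lam', s t) + c * |lam' - lam| := by
    rw [integral_add hsI hcI, setIntegral_const, measureReal_def, hvol,
      ENNReal.toReal_ofReal (abs_nonneg _), smul_eq_mul, mul_comm]
  have hσ : 0 < c * |lam' - lam| := mul_pos hc (abs_pos.2 (sub_ne_zero.2 hne))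
  obtain ⟨δ, hδ, h⟩ := forall_fsAngle_le_of_rigidity hσ (hrig lam hlam) (hrig lam' hlam')
    (hex lam' hlam' hne hlt)
  exact ⟨δ, hδ, fun Ψ Ψ' hΨ hΨ' => (h Ψ Ψ' hΨ hΨ').trans_eq hsplit.symm⟩

end Literature.MathematicalPhysics.QuantumManyBody.BoseGas

end
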